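import Literature.MathematicalPhysics.QuantumFieldTheory.Balaban1983to89.T4JointDressing
import Literature.MathematicalPhysics.QuantumFieldTheory.Balaban1983to89.T4GenFunBounds

/-!
# `Balaban1983to89.T4DressingDefect` — the DRESSING DEFECT `D_t(μ; V_out)` of ONE density-changing step as a TYPED
# OBJECT: the conditional fibre law `E_t[· | V_out]`, the cumulant-generating-function form of the D-term, the oscillation
# (μ-RADIUS) bound, μ-analyticity on a disc — cell T4, node O3b, row T4-O3.E-i (audit cell `pub-balaban`)

HONEST FRAMING.  Audit cell `pub-balaban`, unit `b2b-balaban-pv04` (gen 5; successor of gen 4, which claimed the row and left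
no files), row **T4-O3.E-i** of the cell's T4 programme `HOME/t4/T4-DAG.md` v3 §5.  ROW TEXT (task cell, verbatim): «NE1 part
(i): the D-term D_t^{(k)}(μ; V_out) under convention (α) (and (β)): definition over `T4DressedR` carriers, bound ∣D∣ ≤
∣μ∣·C_W∣Λ(t)∣^q θ_av^{K−k} from O3b.K/O3c, analyticity in μ on the polydisc — `Prop` + sketch — v3: DELIVERABLE RE-DESCRIBED
(T4-REF-O3 V3/V5, pv10-g4 NOTE 20:50:01Z): the D-term as a typed object + μ-analyticity + the osc/μ-RADIUS bound (TRUE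
one-step, `T4OscSandwich`); the SIZE bound B13 §2 consumes is NE1′ = row O3.E-i′»; sources column «B15 (1.76), (1.99)–(1.102),
B16 (1.1); T4DressedR, T4AvgSensitivity».  The node's definition (T4-DAG v3 §2 O3b): `D_t^{(k)}(μ; V_out) := log E_t[w | V_out]
− log w(V_out; V⁰_Λ)`, `E_t` = the conditional law of the integrated term on the fibre `{V : V⌈_{Λᶜ} = V_out}`, `V⁰` a reference
configuration (the critical configuration of Proposition 1, or any other), so that the dressed term reads
`[∫dV⌈_Λ ρ(Z,·)](V_out) · w(V⁰) · e^{D}`.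

ROLE LINE (pv10-g4 NOTE 2026-08-18T20:50:01Z, adopted verbatim in substance).  «one-step dressing-defect bound and μ-analyticity
radius; NOT the multi-scale size input of B13 §2 (see T4-REF-O3 V5 / NE1′: linear parts at squared cost in (2.20)'s quadratic
currency + conditional-mean suppression)».  The oscillation bound `|D_t| ≤ |t|·δ` of §3 is TRUE for one basic step and is the
right μ-RADIUS statement; it is NOT the size that the tube budgets of B13 §2 consume at later scales (T4-REF-O3 V3: with
oscillation sizes the per-cube sums diverge by `L^{2(K−k)}` per scale) — that size is NE1′ = row T4-O3.E-i′ (tree module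
`T4FirstOrderSize`, pv16-g4) and its symmetry half `T4AdInvariant` (pv20-g3).  Nothing in this file should be assembled on as THE
size input of O3.E-iii / U5.

CITATION HEADER — what is taken from T. Bałaban, *Large field renormalization. I. The basic step of the ℝ operation*, Commun.
Math. Phys. 122 (1989) 175–202 [Balaban1989LargeFieldI] is ONLY the printed SHAPE/CONTEXT of the following sentences, re-read by
this seat on the page renders `HOME/b2b-balaban-ref1/pages/1989-cmp122-large-field-I/1989-cmp122-large-field-I-p002-x2.png`
(= p. 176), `…-p020-x2.png` (= p. 194) and `…-p027-x2.png` (= p. 201) (PDF page = journal page − 174), read AS IMAGES: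
* p. 176: «(ℝρ)(V) = Σ_Z ρ(Z″, V) ∫dV⌈_{Z′}ρ(Z, V) / ∫dV⌈_{Z′}ρ(Z″, V). (0.3)» and the normalization property «∫dV(ℝρ)(V) =
  ∫dVρ(V). (0.4)» (loci certified independently: cell GAPS C-pv03-10, C-t4-O3X1-1);
* p. 194, the density-changing Λ-integration: «We obtain a new expression, which we consider as a function of all field
  variables V_k, but independent of V_k⌈_Λ.»; the integrated term «χ_k(Ω_k^{~4})χ_{k,Λ}∫dV_h⌈_{Z_h}χ_h(Ω_h∩Z_h)𝕋_h(Z_h)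
  ∫dV″⌈_{𝔹″_k∩(Λ∩Z_h^c)}χ″_k exp A″_k. (1.76)»; «The two integrals above are over the disjoint regions of integrations, hence
  we can consider them independently.»; and Proposition 1: «… there exists exactly one critical orbit of the function (1.77).
  An element of the orbit is a minimum of the function, and is denoted by V_Λ = V_Λ(V_k⌈_{Z∩Λ^c}).» — CONTEXT ONLY for the
  words "function of V_out = V_k⌈_{Λᶜ}" (our `fibreLaw`/`condLaw`/`dTerm` depend on `V` only through `V⌈_{sᶜ}`, §1) and
  "reference configuration determined by V_out" (our parameter `ref` with `ref (V←y) = ref V`);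
* p. 201: «The above operation has the fundamental normalization property ∫dV_k(ℝ′ρ_k)(V_k) = ∫dV_kρ_k(V_k). (1.102)» (as
  already quoted in `B15BasicStep`/`T4DressedR`; certified C-t4-O3X1-1).
LABELLING (cell ABSOLUTE RULE, honoured).  EVERY declaration below is [folklore]: measure theory / calculus over Mathlib's
`Measure.withDensity`, `Measure.pi`, `ProbabilityTheory.mgf/cgf/complexMGF` and the tree's own carriers (`B15.BasicStep.fibreIntegral`,
`normTerm`, `T4DressedR.RopRealIn`, `T4OscSandwich.loopDressing`, `T4AvgSensitivity.LoopOscBound`).  NO bound, formula or estimate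
of B15/B16/B13 is encoded or asserted; the sensitivity input `LoopOscBound` (node O3c, NE1a) is a HYPOTHESIS SHAPE, NOT PRINTED,
consumed only as `(hW : LoopOscBound …)` exactly as in `T4OscSandwich`/`T4JointDressing`.  The objects `fibreLaw`, `condLaw`,
`dTerm` are THIS MODULE'S MODEL of the words "∫dV⌈_Λ", "E_t[· | V_out]", "D-term" inside the tree's fibre-integral model of
(0.3)/(1.100) (`B15BasicStep`: product of the normalised Haar measures over the bond variables of `Λ`, weighted by the integrated
density); WHICH density `old` (the (1.76) integrand with its gauge fixing, characteristic functions and background — pv16-g4 NOTE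
21:53:34Z (α0): the T-integration law (I), not the (1.101) re-insertion quotient) and WHICH reference `ref` a consumer supplies is
the consumer's reading, recorded in `HOME/t4/T4-EST-O3Ei.md`, not fixed here.  Value = typed object + kernel bookkeeping, NOT summit
progress.

WHAT IS PROVED (zero `sorry`; every hypothesis a Mathlib regularity condition or a named tree predicate):
§0 GENERIC complements to `T4GenFunBounds` §1 (bounded random variable `|X| ≤ B` a.e.): Jensen `t·E[X] ≤ cgf X μ t` and the
   second-order sandwich `cgf X μ t ≤ t·E[X] + t²B²` for `|t|B ≤ 1` (probability measure); on the complex side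
   `‖complexMGF X μ z − 1‖ ≤ 2‖z‖B` (`‖z‖B ≤ 1`), hence `complexMGF z ∈ slitPlane` and `z ↦ log complexMGF z` is
   ℂ-differentiable on the disc `2‖z‖B < 1`, with `‖log complexMGF z‖ ≤ 3‖z‖B` for `4‖z‖B ≤ 1`, and agrees with `cgf` on ℝ.
§1 THE FIBRE LAWS.  `fibreLaw s old V` = (product Haar on the `s`-variables) with density `old(V←y)`; total mass =
   `fibreIntegral s old V` (`toReal_fibreLaw_univ`), finite for bounded `old`; `condLaw` = its normalisation (a probability measure
   iff `fibreIntegral s old V ≠ 0`, else `0` — the printed proviso "the denominators are positive"); both depend on `V` only through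
   `V⌈_{sᶜ}` (`fibreLaw_updateFinset`, `condLaw_updateFinset`); support transfer `ae_condLaw_of_support`.  `fibreVar s F ref V y =
   F(V←y) − F(ref V)`; `condMean` = `E[F | V_out]`; `dTerm s old F ref V t = cgf (fibreVar) (condLaw) t`; `dTermC` its complex
   extension `z ↦ log complexMGF`.
§2 IDENTIFICATION with the tree's literal objects: `mgf_fibreLaw`, `mgf_condLaw`; THE LOG-RATIO FORM `dTerm … t =
   log(∫⌈_s(old·e^{tF})/∫⌈_s old)(V) − t·F(ref V)` (`dTerm_eq_log`); THE FACTORISATION `∫⌈_s(old·e^{tF})(V) = ∫⌈_s old(V) ·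
   e^{tF(ref V)} · e^{D_t}` (`fibreIntegral_dressed_eq`, unconditional: both sides vanish in the degenerate case), its `normTerm`
   and `RopRealIn` forms (`normTerm_dressed_eq`, `ropRealIn_exp_eq_sum` — convention (α): "dressed term = undressed normalised
   term × w(ref) × e^{D}"); and the BRIDGE to `T4JointDressing`: its literal two-body coupling defect is `D_{Λ₁∪Λ₂} − D_{Λ₁} −
   D_{Λ₂}` for the joint fibre law of convention (β) (`abs_dTerm_union_sub_le`, a rewrite of `abs_defect_union_sub_le`).
§3 THE ONE-STEP BOUNDS under an oscillation hypothesis on the support, `|F(V←y) − F(ref V)| ≤ δ` whenever `old(V←y) ≠ 0`: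
   `dTerm 0 = 0`; `|D_t| ≤ |t|δ` (`abs_dTerm_le` — the μ-RADIUS statement); `D` is `δ`-Lipschitz and real-analytic on ℝ;
   `D′(0) = condMean − F(ref V)` with `|condMean − F(ref V)| ≤ δ` and `condMean = ∫(old·F)(V←·)dHaar^s / ∫⌈_s old`
   (Bochner form); second order `|D_t − t·(condMean − F(ref V))| ≤ t²δ²` for `|t|δ ≤ 1`.
§4 μ-ANALYTICITY: `dTermC` restricts to `dTerm` on ℝ, is ℂ-differentiable on the disc `‖z‖ < r` whenever `2rδ ≤ 1`
   (`differentiableOn_dTermC` — the shape of the `MuAnalytic` slot of `T4TermFormat.Carrier`, radius `1/(2δ)`), with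
   `‖D_z‖ ≤ 3‖z‖δ` for `4‖z‖δ ≤ 1`.  ONE complex source is typed; several loops enter through `F = Σ_C μ_C W_C` along each complex
   line (joint analyticity/Hartogs is not available in Mathlib and not claimed).
§5 CONSUMER under `LoopOscBound av dom C_W θ` (node O3c's hypothesis shape), `F = loopDressing av j n x w` (the level-`(j+n)` loop
   variable of the `n`-fold averaged field, `T4OscSandwich`), `ref = id`, pieces supported in `dom j`, measurability of `F` a
   hypothesis (as in `T4JointDressing` §5): `|D_t| ≤ |t|·C_W·|w|·|Λ|·θⁿ`, `|E[F|V_out] − F(V)| ≤ C_W·|w|·|Λ|·θⁿ`, and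
   ℂ-differentiability of `D` on `‖z‖ < r` for `2r·C_W|w||Λ|θⁿ ≤ 1`.
NOT CLAIMED: the NE1′ size (row O3.E-i′); the identification of `old`/`ref` with the (1.76) data; K-uniformity of the radius along
the flow (pv10-g4: `sup_k |Λ(t)|θ^{K−k}` bounded for polylog `R_k` — recorded in the EST record only); measurability of
`loopDressing` (needs `[RegularGaugeGroup G]` and measurable averaging; hypothesis here); multi-source joint analyticity.
-/

open scoped BigOperators ENNReal
open _root_.MeasureTheory _root_.ProbabilityTheory Function Finset Filter

namespace Literature.MathematicalPhysics.QuantumFieldTheory.Balaban1983to89.T4DressingDefect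

open B15.BasicStep T4DressedR T4OscSandwich T4JointDressing T4GenFunBounds T4AvgSensitivity T4Continuum

/-! ## §0 Generic complements: Jensen / second order for `cgf`, the complex logarithm of `complexMGF` near `0` -/

section Generic

variable {Ω : Type*} {mΩ : MeasurableSpace Ω} {X : Ω → ℝ} {μ : Measure Ω} {B : ℝ}

/-- A random variable bounded a.e. under a finite measure is integrable. [folklore] -/
theorem integrable_of_abs_le_ae [IsFiniteMeasure μ] (hX : AEMeasurable X μ) (hB : ∀ᵐ ω ∂μ, |X ω| ≤ B) :
    Integrable X μ :=
  (integrable_const B).mono' hX.aestronglyMeasurable (hB.mono fun ω h => by rwa [Real.norm_eq_abs])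

/-- JENSEN for the cumulant generating function of a bounded variable under a probability measure:
`t·E[X] ≤ log E[e^{tX}]`. [folklore] -/
theorem mul_integral_le_cgf [IsProbabilityMeasure μ] (hX : AEMeasurable X μ) (hB : ∀ᵐ ω ∂μ, |X ω| ≤ B) (t : ℝ) :
    t * μ[X] ≤ cgf X μ t := by
  have hXi : Integrable X μ := integrable_of_abs_le_ae hX hB
  have hint : Integrable (fun ω => Real.exp (t * X ω)) μ := integrable_exp_mul_of_bound hX hB t
  have hJ : Real.exp (∫ ω, t * X ω ∂μ) ≤ ∫ ω, Real.exp (t * X ω) ∂μ :=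
    ConvexOn.map_integral_le (f := fun ω => t * X ω) convexOn_exp Real.continuous_exp.continuousOn isClosed_univ
      (Eventually.of_forall fun _ => Set.mem_univ _) (hXi.const_mul t) hint
  rw [integral_const_mul] at hJ
  show t * μ[X] ≤ Real.log (mgf X μ t)
  exact (Real.le_log_iff_exp_le (mgf_pos hint)).mpr hJ

/-- SECOND ORDER: for `|t|·B ≤ 1`, `log E[e^{tX}] ≤ t·E[X] + t²B²` (from `e^x ≤ 1 + x + x²` on `|x| ≤ 1` and `log y ≤ y − 1`).
[folklore] -/
theorem cgf_le_mul_integral_add_sq [IsProbabilityMeasure μ] (hX : AEMeasurable X μ) (hB : ∀ᵐ ω ∂μ, |X ω| ≤ B)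
    {t : ℝ} (ht : |t| * B ≤ 1) : cgf X μ t ≤ t * μ[X] + t ^ 2 * B ^ 2 := by
  have hXi : Integrable X μ := integrable_of_abs_le_ae hX hB
  have hint : Integrable (fun ω => Real.exp (t * X ω)) μ := integrable_exp_mul_of_bound hX hB t
  have hpt : ∀ᵐ ω ∂μ, Real.exp (t * X ω) ≤ 1 + t * X ω + t ^ 2 * B ^ 2 := hB.mono fun ω hω => by
    have h1 : |t * X ω| ≤ 1 := by
      rw [abs_mul]; exact (mul_le_mul_of_nonneg_left hω (abs_nonneg t)).trans ht
    have h2 := Real.abs_exp_sub_one_sub_id_le h1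
    have h3 : (t * X ω) ^ 2 ≤ t ^ 2 * B ^ 2 := by
      rw [mul_pow]
      exact mul_le_mul_of_nonneg_left (sq_le_sq' (abs_le.mp hω).1 (abs_le.mp hω).2) (sq_nonneg t)
    linarith [(abs_le.mp h2).2]
  have hi0 : Integrable (fun ω => 1 + t * X ω) μ := (integrable_const _).add (hXi.const_mul t)
  have hi1 : Integrable (fun ω => 1 + t * X ω + t ^ 2 * B ^ 2) μ := hi0.add (integrable_const _)
  have hm : mgf X μ t ≤ 1 + t * μ[X] + t ^ 2 * B ^ 2 := by
    have e1 : ∫ ω, (1 + t * X ω + t ^ 2 * B ^ 2) ∂μ = (∫ ω, (1 + t * X ω) ∂μ) + ∫ _ω, (t ^ 2 * B ^ 2 : ℝ) ∂μ :=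
      integral_add hi0 (integrable_const _)
    have e2 : ∫ ω, (1 + t * X ω) ∂μ = (∫ _ω, (1 : ℝ) ∂μ) + ∫ ω, t * X ω ∂μ :=
      integral_add (integrable_const _) (hXi.const_mul t)
    calc mgf X μ t = ∫ ω, Real.exp (t * X ω) ∂μ := rfl
      _ ≤ ∫ ω, (1 + t * X ω + t ^ 2 * B ^ 2) ∂μ := integral_mono_ae hint hi1 hpt
      _ = 1 + t * μ[X] + t ^ 2 * B ^ 2 := by
        rw [e1, e2, integral_const_mul]
        simp
  calc cgf X μ t = Real.log (mgf X μ t) := rfl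
    _ ≤ mgf X μ t - 1 := Real.log_le_sub_one_of_pos (mgf_pos hint)
    _ ≤ t * μ[X] + t ^ 2 * B ^ 2 := by linarith

/-- The two-sided second-order form: `|log E[e^{tX}] − t·E[X]| ≤ t²B²` for `|t|·B ≤ 1`. [folklore] -/
theorem abs_cgf_sub_mul_integral_le [IsProbabilityMeasure μ] (hX : AEMeasurable X μ) (hB : ∀ᵐ ω ∂μ, |X ω| ≤ B)
    {t : ℝ} (ht : |t| * B ≤ 1) : |cgf X μ t - t * μ[X]| ≤ t ^ 2 * B ^ 2 := by
  rw [abs_le]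
  constructor
  · linarith [mul_integral_le_cgf hX hB t, mul_nonneg (sq_nonneg t) (sq_nonneg B)]
  · linarith [cgf_le_mul_integral_add_sq hX hB ht]

/-- `‖E[e^{zX}] − 1‖ ≤ 2‖z‖B` on the disc `‖z‖B ≤ 1` (probability measure; `‖e^u − 1‖ ≤ 2‖u‖` for `‖u‖ ≤ 1`). [folklore] -/
theorem norm_complexMGF_sub_one_le [IsProbabilityMeasure μ] (hX : AEMeasurable X μ) (hB : ∀ᵐ ω ∂μ, |X ω| ≤ B)
    {z : ℂ} (hz : ‖z‖ * B ≤ 1) : ‖complexMGF X μ z - 1‖ ≤ 2 * (‖z‖ * B) := by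
  have hnorm : ∀ᵐ ω ∂μ, ‖z * (X ω : ℂ)‖ ≤ ‖z‖ * B := hB.mono fun ω hω => by
    rw [norm_mul, Complex.norm_real, Real.norm_eq_abs]
    exact mul_le_mul_of_nonneg_left hω (norm_nonneg z)
  have hmeas : AEStronglyMeasurable (fun ω => Complex.exp (z * (X ω : ℂ))) μ :=
    (Complex.measurable_exp.comp_aemeasurable
      ((Complex.measurable_ofReal.comp_aemeasurable hX).const_mul z)).aestronglyMeasurable
  have hint : Integrable (fun ω => Complex.exp (z * (X ω : ℂ))) μ := by
    refine (integrable_const (Real.exp (‖z‖ * B))).mono' hmeas (hnorm.mono fun ω hω => ?_)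
    rw [Complex.norm_exp]
    exact Real.exp_le_exp.mpr ((Complex.re_le_norm _).trans hω)
  have h1 : complexMGF X μ z - 1 = ∫ ω, (Complex.exp (z * (X ω : ℂ)) - 1) ∂μ := by
    rw [integral_sub hint (integrable_const _)]
    simp [complexMGF]
  rw [h1]
  calc ‖∫ ω, (Complex.exp (z * (X ω : ℂ)) - 1) ∂μ‖ ≤ 2 * (‖z‖ * B) * μ.real Set.univ :=
        norm_integral_le_of_norm_le_const (hnorm.mono fun ω hω =>
          (Complex.norm_exp_sub_one_le (hω.trans hz)).trans (mul_le_mul_of_nonneg_left hω zero_le_two))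
    _ = 2 * (‖z‖ * B) := by rw [probReal_univ, mul_one]

/-- … hence on the smaller disc `2‖z‖B < 1` the complex moment generating function lies in the slit plane. [folklore] -/
theorem complexMGF_mem_slitPlane [IsProbabilityMeasure μ] (hX : AEMeasurable X μ) (hB : ∀ᵐ ω ∂μ, |X ω| ≤ B)
    {z : ℂ} (hz : 2 * (‖z‖ * B) < 1) : complexMGF X μ z ∈ Complex.slitPlane := by
  have h := norm_complexMGF_sub_one_le hX hB (show ‖z‖ * B ≤ 1 by linarith)
  rw [show complexMGF X μ z = 1 + (complexMGF X μ z - 1) by ring]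
  exact Complex.mem_slitPlane_of_norm_lt_one (lt_of_le_of_lt h hz)

/-- … and `z ↦ log E[e^{zX}]` is ℂ-differentiable there. [folklore] -/
theorem differentiableAt_log_complexMGF [IsProbabilityMeasure μ] (hX : AEMeasurable X μ) (hB : ∀ᵐ ω ∂μ, |X ω| ≤ B)
    {z : ℂ} (hz : 2 * (‖z‖ * B) < 1) :
    DifferentiableAt ℂ (fun z => Complex.log (complexMGF X μ z)) z :=
  ((differentiable_complexMGF_of_abs_le hX hB) z).clog (complexMGF_mem_slitPlane hX hB hz)

/-- DISC FORM: `z ↦ log E[e^{zX}]` is ℂ-differentiable on the open disc `‖z‖ < r` as soon as `2rB ≤ 1`. [folklore] -/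
theorem differentiableOn_log_complexMGF_ball [IsProbabilityMeasure μ] (hX : AEMeasurable X μ)
    (hB : ∀ᵐ ω ∂μ, |X ω| ≤ B) {r : ℝ} (hr : 2 * (r * B) ≤ 1) :
    DifferentiableOn ℂ (fun z => Complex.log (complexMGF X μ z)) (Metric.ball 0 r) := by
  intro z hz
  have hzr : ‖z‖ < r := by simpa using hz
  have hB0 : 0 ≤ B := nonneg_of_ae_abs_le (IsProbabilityMeasure.ne_zero μ) hB
  have hz' : 2 * (‖z‖ * B) < 1 := by
    rcases hB0.eq_or_lt with hB0 | hBpos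
    · rw [← hB0, mul_zero, mul_zero]; exact zero_lt_one
    · exact lt_of_lt_of_le (by nlinarith [norm_nonneg z]) hr
  exact (differentiableAt_log_complexMGF hX hB hz').differentiableWithinAt

/-- NORM BOUND: `‖log E[e^{zX}]‖ ≤ 3‖z‖B` for `4‖z‖B ≤ 1` (`‖log(1+u)‖ ≤ (3/2)‖u‖` for `‖u‖ ≤ 1/2`). [folklore] -/
theorem norm_log_complexMGF_le [IsProbabilityMeasure μ] (hX : AEMeasurable X μ) (hB : ∀ᵐ ω ∂μ, |X ω| ≤ B)
    {z : ℂ} (hz : 4 * (‖z‖ * B) ≤ 1) : ‖Complex.log (complexMGF X μ z)‖ ≤ 3 * (‖z‖ * B) := by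
  have h := norm_complexMGF_sub_one_le hX hB (show ‖z‖ * B ≤ 1 by linarith)
  have hhalf : ‖complexMGF X μ z - 1‖ ≤ 1 / 2 := h.trans (by linarith)
  rw [show complexMGF X μ z = 1 + (complexMGF X μ z - 1) by ring]
  calc ‖Complex.log (1 + (complexMGF X μ z - 1))‖ ≤ 3 / 2 * ‖complexMGF X μ z - 1‖ :=
        Complex.norm_log_one_add_half_le_self hhalf
    _ ≤ 3 / 2 * (2 * (‖z‖ * B)) := by gcongr
    _ = 3 * (‖z‖ * B) := by ring

/-- On the real axis the complex logarithm of the complex moment generating function IS the cumulant generating function.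
[folklore] -/
theorem log_complexMGF_ofReal (t : ℝ) : Complex.log (complexMGF X μ (t : ℂ)) = ((cgf X μ t : ℝ) : ℂ) := by
  rw [complexMGF_ofReal, cgf, Complex.ofReal_log mgf_nonneg]

end Generic

/-! ## §1 The fibre laws through `V`, the conditional law `E_t[· | V_out]`, the D-term -/

section SetupLevel

variable {P : Params} {j : ℕ} {G : Type*} [GaugeGroup G] [MeasurableSpace G] [HaarData G]
variable [DecidableEq (PBond P j)]

/-- THE FIBRE LAW of the integrated density `old` through `V`: the product of the normalised Haar measures over the bond
variables `b ∈ s` (= `Λ`), weighted by `old(V←y)` (`V←y := updateFinset V s y`).  Its total mass is the tree's restricted integral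
`∫dV⌈_s old (V)` (`toReal_fibreLaw_univ`).  This module's MODEL of the words "integration with respect to the field variables over the
domain Λ" (p. 194) inside the fibre-integral model of (0.3) (`B15BasicStep.fibreIntegral`). [folklore] -/
noncomputable def fibreLaw (s : Finset (PBond P j)) (old : Density P j G) (V : GaugeField P j G) : Measure (s → G) :=
  (Measure.pi fun _ : s => (HaarData.haar : Measure G)).withDensity
    fun y => ENNReal.ofReal (old (updateFinset V s y))

/-- THE CONDITIONAL LAW `E_t[· | V_out]`: the fibre law normalised to a probability measure (it is `0` when the fibre integral
vanishes — the printed proviso «the denominators are positive», p. 176, is the hypothesis `fibreIntegral s old V ≠ 0` below).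
[folklore] -/
noncomputable def condLaw (s : Finset (PBond P j)) (old : Density P j G) (V : GaugeField P j G) : Measure (s → G) :=
  (fibreLaw s old V Set.univ)⁻¹ • fibreLaw s old V

omit [GaugeGroup G] [MeasurableSpace G] [HaarData G] in
/-- THE FIBRE VARIABLE of a dressing exponent `F` relative to a reference configuration `ref V`:
`y ↦ F(V←y) − F(ref V)` (`ref = id`: the base point itself; `ref V = ` the critical configuration `V_Λ(V⌈_{Λᶜ})` of
Proposition 1 p. 194 is the node's `V⁰` — CONTEXT only, any `ref` is allowed). [folklore] -/
def fibreVar (s : Finset (PBond P j)) (F : Density P j G) (ref : GaugeField P j G → GaugeField P j G)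
    (V : GaugeField P j G) : (s → G) → ℝ :=
  fun y => F (updateFinset V s y) - F (ref V)

/-- THE CONDITIONAL MEAN `E_t[F | V_out]` (Bochner integral against `condLaw`; `= 0` in the degenerate case). [folklore] -/
noncomputable def condMean (s : Finset (PBond P j)) (old F : Density P j G) (V : GaugeField P j G) : ℝ :=
  ∫ y, F (updateFinset V s y) ∂(condLaw s old V)

/-- THE D-TERM `D_t(V_out) = log E_t[e^{t(F − F(ref))} | V_out]` = the cumulant generating function of the fibre variable under
the conditional law (node O3b: `log E_t[w | V_out] − log w(V⁰)` for `w = e^{tF}`).  Junk value `0` when the fibre integral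
vanishes. [folklore] -/
noncomputable def dTerm (s : Finset (PBond P j)) (old F : Density P j G) (ref : GaugeField P j G → GaugeField P j G)
    (V : GaugeField P j G) : ℝ → ℝ :=
  cgf (fibreVar s F ref V) (condLaw s old V)

/-- THE COMPLEX D-TERM `z ↦ log E_t[e^{z(F − F(ref))} | V_out]` (principal branch; it is the analytic continuation of `dTerm`
on the disc of §4). [folklore] -/
noncomputable def dTermC (s : Finset (PBond P j)) (old F : Density P j G) (ref : GaugeField P j G → GaugeField P j G)
    (V : GaugeField P j G) : ℂ → ℂ :=
  fun z => Complex.log (complexMGF (fibreVar s F ref V) (condLaw s old V) z)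

/-- Total mass of the fibre law = the `lmarginal` defining `fibreIntegral`. [folklore] -/
theorem fibreLaw_apply_univ (s : Finset (PBond P j)) (old : Density P j G) (V : GaugeField P j G) :
    fibreLaw s old V Set.univ
      = (∫⋯∫⁻_s, (fun U => ENNReal.ofReal (old U)) ∂(fun _ : PBond P j => (HaarData.haar : Measure G))) V := by
  rw [fibreLaw, withDensity_apply _ MeasurableSet.univ, Measure.restrict_univ]
  rfl

/-- `(fibreLaw s old V)(univ).toReal = ∫dV⌈_s old (V)`. [folklore] -/
theorem toReal_fibreLaw_univ (s : Finset (PBond P j)) (old : Density P j G) (V : GaugeField P j G) :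
    (fibreLaw s old V Set.univ).toReal = fibreIntegral s old V := by
  rw [fibreLaw_apply_univ]; rfl

/-- Real-mass form. [folklore] -/
theorem fibreLaw_real_univ (s : Finset (PBond P j)) (old : Density P j G) (V : GaugeField P j G) :
    (fibreLaw s old V).real Set.univ = fibreIntegral s old V := by
  rw [measureReal_def, toReal_fibreLaw_univ]

/-- A bounded integrated density has a FINITE fibre law. [folklore] -/
theorem isFiniteMeasure_fibreLaw (s : Finset (PBond P j)) {old : Density P j G} {C : ℝ} (hC : ∀ U, old U ≤ C)
    (V : GaugeField P j G) : IsFiniteMeasure (fibreLaw s old V) := by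
  refine ⟨?_⟩
  rw [fibreLaw_apply_univ]
  exact lt_of_le_of_lt (lmarginal_ofReal_le s hC V) ENNReal.ofReal_lt_top

/-- Non-vanishing fibre integral ⇒ non-zero mass. [folklore] -/
theorem fibreLaw_univ_ne_zero (s : Finset (PBond P j)) {old : Density P j G} (V : GaugeField P j G)
    (hne : fibreIntegral s old V ≠ 0) : fibreLaw s old V Set.univ ≠ 0 := fun h =>
  hne (by rw [← toReal_fibreLaw_univ, h, ENNReal.toReal_zero])

/-- Vanishing fibre integral (bounded density) ⇒ zero mass. [folklore] -/
theorem fibreLaw_univ_eq_zero (s : Finset (PBond P j)) {old : Density P j G} {C : ℝ} (hC : ∀ U, old U ≤ C)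
    (V : GaugeField P j G) (h0 : fibreIntegral s old V = 0) : fibreLaw s old V Set.univ = 0 := by
  haveI := isFiniteMeasure_fibreLaw s hC V
  rw [← toReal_fibreLaw_univ, ENNReal.toReal_eq_zero_iff] at h0
  exact h0.resolve_right (measure_lt_top _ _).ne

/-- … and then the conditional law is the zero measure (junk case). [folklore] -/
theorem condLaw_eq_zero (s : Finset (PBond P j)) {old : Density P j G} {C : ℝ} (hC : ∀ U, old U ≤ C)
    (V : GaugeField P j G) (h0 : fibreIntegral s old V = 0) : condLaw s old V = 0 := by
  rw [condLaw, Measure.measure_univ_eq_zero.mp (fibreLaw_univ_eq_zero s hC V h0), smul_zero]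

/-- Under the printed proviso the conditional law IS a probability measure. [folklore] -/
theorem isProbabilityMeasure_condLaw (s : Finset (PBond P j)) {old : Density P j G} {C : ℝ} (hC : ∀ U, old U ≤ C)
    (V : GaugeField P j G) (hne : fibreIntegral s old V ≠ 0) : IsProbabilityMeasure (condLaw s old V) := by
  haveI := isFiniteMeasure_fibreLaw s hC V
  haveI : NeZero (fibreLaw s old V) :=
    ⟨fun h => fibreLaw_univ_ne_zero s V hne (by rw [h, Measure.coe_zero, Pi.zero_apply])⟩
  unfold condLaw
  exact isProbabilityMeasureSMul

/-- In general it is zero-or-probability (hence finite). [folklore] -/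
theorem isZeroOrProbabilityMeasure_condLaw (s : Finset (PBond P j)) {old : Density P j G} {C : ℝ}
    (hC : ∀ U, old U ≤ C) (V : GaugeField P j G) : IsZeroOrProbabilityMeasure (condLaw s old V) := by
  by_cases h0 : fibreIntegral s old V = 0
  · rw [condLaw_eq_zero s hC V h0]; infer_instance
  · haveI := isProbabilityMeasure_condLaw s hC V h0; infer_instance

/-- FIBRE CONSTANCY: the fibre law depends on `V` only through `V⌈_{sᶜ}` (p. 194 «independent of V_k⌈_Λ»). [folklore] -/
theorem fibreLaw_updateFinset (s : Finset (PBond P j)) (old : Density P j G) (V : GaugeField P j G) (y₀ : s → G) :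
    fibreLaw s old (updateFinset V s y₀) = fibreLaw s old V := by
  simp only [fibreLaw, updateFinset_updateFinset_of_subset (Finset.Subset.refl s)]

/-- … and so does the conditional law. [folklore] -/
theorem condLaw_updateFinset (s : Finset (PBond P j)) (old : Density P j G) (V : GaugeField P j G) (y₀ : s → G) :
    condLaw s old (updateFinset V s y₀) = condLaw s old V := by
  unfold condLaw; rw [fibreLaw_updateFinset]

/-- … and the conditional mean. [folklore] -/
theorem condMean_updateFinset (s : Finset (PBond P j)) (old F : Density P j G) (V : GaugeField P j G) (y₀ : s → G) :
    condMean s old F (updateFinset V s y₀) = condMean s old F V := by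
  simp only [condMean, condLaw_updateFinset, updateFinset_updateFinset_of_subset (Finset.Subset.refl s)]

omit [GaugeGroup G] [MeasurableSpace G] [HaarData G] in
/-- … and the fibre variable, for a reference map that is itself a function of `V⌈_{sᶜ}` (e.g. `V ↦ V_Λ(V⌈_{Λᶜ})`, or a
constant; NOT `ref = id`). [folklore] -/
theorem fibreVar_updateFinset (s : Finset (PBond P j)) (F : Density P j G) {ref : GaugeField P j G → GaugeField P j G}
    (href : ∀ (V : GaugeField P j G) (y : s → G), ref (updateFinset V s y) = ref V) (V : GaugeField P j G) (y₀ : s → G) :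
    fibreVar s F ref (updateFinset V s y₀) = fibreVar s F ref V := by
  funext y
  simp only [fibreVar, updateFinset_updateFinset_of_subset (Finset.Subset.refl s), href]

/-- … hence the D-term is a function of `V_out = V⌈_{sᶜ}` for such reference maps. [folklore] -/
theorem dTerm_updateFinset (s : Finset (PBond P j)) (old F : Density P j G) {ref : GaugeField P j G → GaugeField P j G}
    (href : ∀ (V : GaugeField P j G) (y : s → G), ref (updateFinset V s y) = ref V) (V : GaugeField P j G) (y₀ : s → G) :
    dTerm s old F ref (updateFinset V s y₀) = dTerm s old F ref V := by
  unfold dTerm; rw [fibreVar_updateFinset s F href, condLaw_updateFinset]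

/-- … and so is the complex D-term. [folklore] -/
theorem dTermC_updateFinset (s : Finset (PBond P j)) (old F : Density P j G) {ref : GaugeField P j G → GaugeField P j G}
    (href : ∀ (V : GaugeField P j G) (y : s → G), ref (updateFinset V s y) = ref V) (V : GaugeField P j G) (y₀ : s → G) :
    dTermC s old F ref (updateFinset V s y₀) = dTermC s old F ref V := by
  unfold dTermC; rw [fibreVar_updateFinset s F href, condLaw_updateFinset]

/-- SUPPORT TRANSFER: a property holding at every fibre point where `old ≠ 0` holds `fibreLaw`-a.e. [folklore] -/
theorem ae_fibreLaw_of_support (s : Finset (PBond P j)) {old : Density P j G} (hm : Measurable old) (V : GaugeField P j G)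
    {p : (s → G) → Prop} (h : ∀ y : s → G, old (updateFinset V s y) ≠ 0 → p y) : ∀ᵐ y ∂(fibreLaw s old V), p y := by
  have hdens : Measurable fun y : s → G => ENNReal.ofReal (old (updateFinset V s y)) :=
    ENNReal.measurable_ofReal.comp (hm.comp measurable_updateFinset)
  rw [fibreLaw, ae_withDensity_iff hdens]
  exact Eventually.of_forall fun y hy => h y fun h0 => hy (by rw [h0, ENNReal.ofReal_zero])

/-- … and `condLaw`-a.e. [folklore] -/
theorem ae_condLaw_of_support (s : Finset (PBond P j)) {old : Density P j G} (hm : Measurable old) (V : GaugeField P j G)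
    {p : (s → G) → Prop} (h : ∀ y : s → G, old (updateFinset V s y) ≠ 0 → p y) : ∀ᵐ y ∂(condLaw s old V), p y := by
  rw [condLaw]; exact Measure.ae_smul_measure (ae_fibreLaw_of_support s hm V h) _

omit [GaugeGroup G] [HaarData G] in
/-- The fibre variable of a measurable exponent is measurable. [folklore] -/
theorem measurable_fibreVar (s : Finset (PBond P j)) {F : Density P j G} (hF : Measurable F)
    (ref : GaugeField P j G → GaugeField P j G) (V : GaugeField P j G) : Measurable (fibreVar s F ref V) :=
  (hF.comp measurable_updateFinset).sub measurable_const

/-- AN OSCILLATION BOUND ON THE SUPPORT becomes an a.e. bound on the fibre variable under the conditional law. [folklore] -/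
theorem ae_abs_fibreVar_le (s : Finset (PBond P j)) {old : Density P j G} (hm : Measurable old) {F : Density P j G}
    (ref : GaugeField P j G → GaugeField P j G) (V : GaugeField P j G) {δ : ℝ}
    (hosc : ∀ y : s → G, old (updateFinset V s y) ≠ 0 → |F (updateFinset V s y) - F (ref V)| ≤ δ) :
    ∀ᵐ y ∂(condLaw s old V), |fibreVar s F ref V y| ≤ δ :=
  ae_condLaw_of_support s hm V hosc

/-! ## §2 Identification with the tree's literal objects: `mgf`, the log-ratio form, the factorisation, the bridge -/

/-- THE MOMENT GENERATING FUNCTION OF THE FIBRE LAW is the dressed fibre integral: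
`∫ e^{t(F(V←y) − F(ref V))} dfibreLaw = e^{−tF(ref V)} · ∫dV⌈_s(old·e^{tF})(V)`. [folklore] -/
theorem mgf_fibreLaw (s : Finset (PBond P j)) {old : Density P j G} (hm : Measurable old) (h0 : ∀ U, 0 ≤ old U)
    {F : Density P j G} (hF : Measurable F) (ref : GaugeField P j G → GaugeField P j G) (V : GaugeField P j G) (t : ℝ) :
    mgf (fibreVar s F ref V) (fibreLaw s old V) t
      = Real.exp (-(t * F (ref V))) * fibreIntegral s (fun U => old U * Real.exp (t * F U)) V := by
  have hXm : Measurable (fibreVar s F ref V) := measurable_fibreVar s hF ref V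
  have hexp : Measurable fun y : s → G => Real.exp (t * fibreVar s F ref V y) :=
    Real.measurable_exp.comp (hXm.const_mul t)
  have hexp' : Measurable fun y : s → G => ENNReal.ofReal (Real.exp (t * fibreVar s F ref V y)) :=
    ENNReal.measurable_ofReal.comp hexp
  have hdens : Measurable fun y : s → G => ENNReal.ofReal (old (updateFinset V s y)) :=
    ENNReal.measurable_ofReal.comp (hm.comp measurable_updateFinset)
  have hprod : Measurable fun y : s → G =>
      ENNReal.ofReal (old (updateFinset V s y) * Real.exp (t * F (updateFinset V s y))) :=
    ENNReal.measurable_ofReal.comp ((hm.comp measurable_updateFinset).mul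
      (Real.measurable_exp.comp ((hF.comp measurable_updateFinset).const_mul t)))
  have hpt : ((fun y : s → G => ENNReal.ofReal (old (updateFinset V s y))) *
        fun y => ENNReal.ofReal (Real.exp (t * fibreVar s F ref V y)))
      = fun y => ENNReal.ofReal (old (updateFinset V s y) * Real.exp (t * F (updateFinset V s y)))
          * ENNReal.ofReal (Real.exp (-(t * F (ref V)))) := by
    funext y
    simp only [Pi.mul_apply, fibreVar]
    rw [mul_sub, sub_eq_add_neg, Real.exp_add, ENNReal.ofReal_mul (Real.exp_pos _).le,
      ENNReal.ofReal_mul (h0 _), mul_assoc]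
  rw [mgf, integral_eq_lintegral_of_nonneg_ae (Eventually.of_forall fun y => (Real.exp_pos _).le)
    hexp.aestronglyMeasurable]
  rw [fibreLaw, lintegral_withDensity_eq_lintegral_mul₀ hdens.aemeasurable hexp'.aemeasurable, hpt,
    lintegral_mul_const _ hprod, ENNReal.toReal_mul,
    ENNReal.toReal_ofReal (Real.exp_pos _).le, mul_comm]
  rfl

/-- … and OF THE CONDITIONAL LAW: `E_t[e^{t(F − F(ref V))} | V_out] = (∫⌈_s(old·e^{tF})/∫⌈_s old)(V) · e^{−tF(ref V)}`
(both sides `0` in the degenerate case). [folklore] -/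
theorem mgf_condLaw (s : Finset (PBond P j)) {old : Density P j G} (hm : Measurable old) (h0 : ∀ U, 0 ≤ old U)
    {F : Density P j G} (hF : Measurable F) (ref : GaugeField P j G → GaugeField P j G) (V : GaugeField P j G) (t : ℝ) :
    mgf (fibreVar s F ref V) (condLaw s old V) t
      = fibreIntegral s (fun U => old U * Real.exp (t * F U)) V / fibreIntegral s old V * Real.exp (-(t * F (ref V))) := by
  rw [condLaw, mgf_smul_measure, ENNReal.toReal_inv, toReal_fibreLaw_univ, mgf_fibreLaw s hm h0 hF ref V t]
  ring

/-- Degenerate case: vanishing fibre integral ⇒ `D ≡ 0` (junk value). [folklore] -/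
theorem dTerm_of_fibreIntegral_eq_zero (s : Finset (PBond P j)) {old : Density P j G} {C : ℝ} (hC : ∀ U, old U ≤ C)
    (F : Density P j G) (ref : GaugeField P j G → GaugeField P j G) (V : GaugeField P j G)
    (h0 : fibreIntegral s old V = 0) (t : ℝ) : dTerm s old F ref V t = 0 := by
  rw [dTerm, condLaw_eq_zero s hC V h0, cgf_zero_measure, Pi.zero_apply]

/-- THE LOG-RATIO FORM (the node's definition, literally): under the printed proviso,
`D_t(V_out) = log( ∫dV⌈_s(old·e^{tF})(V) / ∫dV⌈_s old(V) ) − t·F(ref V)`. [folklore] -/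
theorem dTerm_eq_log (s : Finset (PBond P j)) {old : Density P j G} (hm : Measurable old) (h0 : ∀ U, 0 ≤ old U)
    {C : ℝ} (hC : ∀ U, old U ≤ C) {F : Density P j G} (hF : Measurable F) {B : ℝ} (hFB : ∀ U, |F U| ≤ B)
    (ref : GaugeField P j G → GaugeField P j G) (V : GaugeField P j G) (t : ℝ) (hne : fibreIntegral s old V ≠ 0) :
    dTerm s old F ref V t
      = Real.log (fibreIntegral s (fun U => old U * Real.exp (t * F U)) V / fibreIntegral s old V) - t * F (ref V) := by
  have hD : 0 < fibreIntegral s (fun U => old U * Real.exp (t * F U)) V :=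
    fibreIntegral_exp_dressed_pos s F h0 hC hFB t V hne
  have hI : 0 < fibreIntegral s old V := lt_of_le_of_ne (fibreIntegral_nonneg s old V) (Ne.symm hne)
  show Real.log (mgf (fibreVar s F ref V) (condLaw s old V) t) = _
  rw [mgf_condLaw s hm h0 hF ref V t, Real.log_mul (div_pos hD hI).ne' (Real.exp_pos _).ne', Real.log_exp]
  ring

/-- EXPONENTIAL FORM: `e^{D_t} = (∫⌈_s(old·e^{tF})/∫⌈_s old)(V) · e^{−tF(ref V)}` under the proviso. [folklore] -/
theorem exp_dTerm_eq (s : Finset (PBond P j)) {old : Density P j G} (hm : Measurable old) (h0 : ∀ U, 0 ≤ old U)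
    {C : ℝ} (hC : ∀ U, old U ≤ C) {F : Density P j G} (hF : Measurable F) {B : ℝ} (hFB : ∀ U, |F U| ≤ B)
    (ref : GaugeField P j G → GaugeField P j G) (V : GaugeField P j G) (t : ℝ) (hne : fibreIntegral s old V ≠ 0) :
    Real.exp (dTerm s old F ref V t)
      = fibreIntegral s (fun U => old U * Real.exp (t * F U)) V / fibreIntegral s old V * Real.exp (-(t * F (ref V))) := by
  have hD : 0 < fibreIntegral s (fun U => old U * Real.exp (t * F U)) V :=
    fibreIntegral_exp_dressed_pos s F h0 hC hFB t V hne
  have hI : 0 < fibreIntegral s old V := lt_of_le_of_ne (fibreIntegral_nonneg s old V) (Ne.symm hne)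
  have hpos : 0 < mgf (fibreVar s F ref V) (condLaw s old V) t := by
    rw [mgf_condLaw s hm h0 hF ref V t]; exact mul_pos (div_pos hD hI) (Real.exp_pos _)
  show Real.exp (Real.log (mgf (fibreVar s F ref V) (condLaw s old V) t)) = _
  rw [Real.exp_log hpos, mgf_condLaw s hm h0 hF ref V t]

/-- THE FACTORISATION OF THE DRESSED FIBRE INTEGRAL (unconditional):
`∫dV⌈_s(old·e^{tF})(V) = ∫dV⌈_s old(V) · e^{tF(ref V)} · e^{D_t(V_out)}` — "integrated term × w(V⁰) × e^{D}". [folklore] -/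
theorem fibreIntegral_dressed_eq (s : Finset (PBond P j)) {old : Density P j G} (hm : Measurable old) (h0 : ∀ U, 0 ≤ old U)
    {C : ℝ} (hC : ∀ U, old U ≤ C) {F : Density P j G} (hF : Measurable F) {B : ℝ} (hFB : ∀ U, |F U| ≤ B)
    (ref : GaugeField P j G → GaugeField P j G) (V : GaugeField P j G) (t : ℝ) :
    fibreIntegral s (fun U => old U * Real.exp (t * F U)) V
      = fibreIntegral s old V * Real.exp (t * F (ref V)) * Real.exp (dTerm s old F ref V t) := by
  by_cases hne : fibreIntegral s old V = 0
  · have hle := fibreIntegral_mul_le_at s h0 hC V (w := fun U => Real.exp (t * F U)) (Real.exp_pos (|t| * B)).le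
      (fun y _ => (exp_dressing_bounds hFB t _).2)
    rw [hne, mul_zero] at hle
    have hz : fibreIntegral s (fun U => old U * Real.exp (t * F U)) V = 0 :=
      le_antisymm hle (fibreIntegral_nonneg s _ V)
    rw [hz, hne, zero_mul, zero_mul]
  · rw [exp_dTerm_eq s hm h0 hC hF hFB ref V t hne, Real.exp_neg]
    field_simp

/-- THE NORMALISED-TERM FORM (convention (α), one term of (0.3)/(1.100)): the dressed normalised term equals the undressed
one times `e^{tF(ref V)}·e^{D_t(V_out)}`. [folklore] -/
theorem normTerm_dressed_eq (s : Finset (PBond P j)) (ins : Density P j G) {old : Density P j G} (hm : Measurable old)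
    (h0 : ∀ U, 0 ≤ old U) {C : ℝ} (hC : ∀ U, old U ≤ C) {F : Density P j G} (hF : Measurable F) {B : ℝ}
    (hFB : ∀ U, |F U| ≤ B) (ref : GaugeField P j G → GaugeField P j G) (V : GaugeField P j G) (t : ℝ) :
    normTerm s ins (fun U => old U * Real.exp (t * F U)) V
      = normTerm s ins old V * Real.exp (t * F (ref V)) * Real.exp (dTerm s old F ref V t) := by
  simp only [normTerm]
  rw [fibreIntegral_dressed_eq s hm h0 hC hF hFB ref V t]
  ring

/-- THE DRESSED OPERATION, TERMWISE: `ℝ′_in(ρ·e^{tF})(V) = Σ_Z [normalised term Z](V) · e^{tF(ref_Z V)} · e^{D_{t,Z}(V)}` with a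
term-dependent reference map `ref_Z` (e.g. the critical configuration of the term's own `Λ(Z)`). [folklore] -/
theorem ropRealIn_exp_eq_sum {R : Type*} [Fintype R] (piece : R → Density P j G) (pp : R → R)
    (fib : R → Finset (PBond P j)) (hm : ∀ Z, Measurable (piece Z)) (h0 : ∀ Z U, 0 ≤ piece Z U) {C : ℝ}
    (hC : ∀ Z U, piece Z U ≤ C) {F : Density P j G} (hF : Measurable F) {B : ℝ} (hFB : ∀ U, |F U| ≤ B)
    (ref : R → GaugeField P j G → GaugeField P j G) (t : ℝ) (V : GaugeField P j G) :
    RopRealIn piece pp fib (fun U => Real.exp (t * F U)) V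
      = ∑ Z, normTerm (fib Z) (piece (pp Z)) (piece Z) V * Real.exp (t * F (ref Z V))
          * Real.exp (dTerm (fib Z) (piece Z) F (ref Z) V t) := by
  simp only [RopRealIn]
  exact Finset.sum_congr rfl fun Z _ => normTerm_dressed_eq (fib Z) (piece (pp Z)) (hm Z) (h0 Z) (hC Z) hF hFB (ref Z) V t

/-- BRIDGE TO `T4JointDressing` (convention (β)): its literal two-body coupling defect IS `D_{Λ₁∪Λ₂} − D_{Λ₁} − D_{Λ₂}` for the
joint fibre law of `old₁·old₂` over `Λ₁ ∪ Λ₂` (base point as reference), hence `≤ |t|·δ` under the mixed second-difference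
hypothesis of `abs_defect_union_sub_le`. [folklore] -/
theorem abs_dTerm_union_sub_le {s₁ s₂ : Finset (PBond P j)} (hd : Disjoint s₁ s₂) {old₁ old₂ : Density P j G}
    (F : Density P j G) (hm₁ : Measurable old₁) (hm₂ : Measurable old₂) (hF : Measurable F)
    (h0₁ : ∀ U, 0 ≤ old₁ U) (h0₂ : ∀ U, 0 ≤ old₂ U) {C : ℝ} (hC₁ : ∀ U, old₁ U ≤ C) (hC₂ : ∀ U, old₂ U ≤ C)
    (hI₁ : FibreIndep s₂ old₁) (hI₂ : FibreIndep s₁ old₂) {B : ℝ} (hFB : ∀ U, |F U| ≤ B) (t δ : ℝ) (V : GaugeField P j G)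
    (hmix : ∀ (y : s₁ → G) (z : s₂ → G), old₁ (updateFinset V s₁ y) ≠ 0 → old₂ (updateFinset V s₂ z) ≠ 0 →
      |F (updateFinset (updateFinset V s₁ y) s₂ z) - F (updateFinset V s₁ y) - F (updateFinset V s₂ z) + F V| ≤ δ)
    (hne₁ : fibreIntegral s₁ old₁ V ≠ 0) (hne₂ : fibreIntegral s₂ old₂ V ≠ 0) :
    |dTerm (s₁ ∪ s₂) (fun U => old₁ U * old₂ U) F id V t - dTerm s₁ old₁ F id V t - dTerm s₂ old₂ F id V t|
      ≤ |t| * δ := by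
  have hne : fibreIntegral (s₁ ∪ s₂) (fun U => old₁ U * old₂ U) V ≠ 0 := by
    rw [fibreIntegral_union_mul_eq hd hm₁ hm₂ h0₁ hC₁ hC₂ hI₁ hI₂ V]; exact mul_ne_zero hne₁ hne₂
  have hC₁₂ : ∀ U, old₁ U * old₂ U ≤ C * C := fun U =>
    mul_le_mul (hC₁ U) (hC₂ U) (h0₂ U) ((h0₁ U).trans (hC₁ U))
  rw [dTerm_eq_log (s₁ ∪ s₂) (old := fun U => old₁ U * old₂ U) (hm₁.mul hm₂) (fun U => mul_nonneg (h0₁ U) (h0₂ U))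
      hC₁₂ hF hFB id V t hne,
    dTerm_eq_log s₁ hm₁ h0₁ hC₁ hF hFB id V t hne₁, dTerm_eq_log s₂ hm₂ h0₂ hC₂ hF hFB id V t hne₂]
  exact abs_defect_union_sub_le hd F hm₁ hm₂ hF h0₁ h0₂ hC₁ hC₂ hI₁ hI₂ hFB t δ V hmix hne₁ hne₂

/-! ## §3 The one-step bounds under an oscillation hypothesis on the support -/

/-- `D_0 = 0`. [folklore] -/
theorem dTerm_zero (s : Finset (PBond P j)) {old : Density P j G} {C : ℝ} (hC : ∀ U, old U ≤ C) (F : Density P j G)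
    (ref : GaugeField P j G → GaugeField P j G) (V : GaugeField P j G) : dTerm s old F ref V 0 = 0 := by
  haveI := isZeroOrProbabilityMeasure_condLaw s hC V (old := old)
  exact cgf_zero

/-- THE μ-RADIUS BOUND (TRUE one-step statement of the row): if the exponent oscillates by at most `δ` over the SUPPORT of the
integrated density in the fibre through `V` (`|F(V←y) − F(ref V)| ≤ δ` whenever `old(V←y) ≠ 0`), then `|D_t(V_out)| ≤ |t|·δ`
for every real `t`. [folklore] -/
theorem abs_dTerm_le (s : Finset (PBond P j)) {old : Density P j G} (hm : Measurable old) {C : ℝ} (hC : ∀ U, old U ≤ C)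
    {F : Density P j G} (hF : Measurable F) (ref : GaugeField P j G → GaugeField P j G) (V : GaugeField P j G) {δ : ℝ}
    (hosc : ∀ y : s → G, old (updateFinset V s y) ≠ 0 → |F (updateFinset V s y) - F (ref V)| ≤ δ)
    (hne : fibreIntegral s old V ≠ 0) (t : ℝ) : |dTerm s old F ref V t| ≤ |t| * δ := by
  haveI := isProbabilityMeasure_condLaw s hC V hne
  have h := abs_cgf_sub_log_le_of_abs_le (μ := condLaw s old V) (measurable_fibreVar s hF ref V).aemeasurable
    (ae_abs_fibreVar_le s hm ref V hosc) t
  rwa [probReal_univ, Real.log_one, sub_zero] at h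

/-- Unconditional form for a non-negative budget (the degenerate case has `D ≡ 0`). [folklore] -/
theorem abs_dTerm_le' (s : Finset (PBond P j)) {old : Density P j G} (hm : Measurable old) {C : ℝ} (hC : ∀ U, old U ≤ C)
    {F : Density P j G} (hF : Measurable F) (ref : GaugeField P j G → GaugeField P j G) (V : GaugeField P j G) {δ : ℝ}
    (hδ : 0 ≤ δ) (hosc : ∀ y : s → G, old (updateFinset V s y) ≠ 0 → |F (updateFinset V s y) - F (ref V)| ≤ δ)
    (t : ℝ) : |dTerm s old F ref V t| ≤ |t| * δ := by
  by_cases hne : fibreIntegral s old V = 0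
  · rw [dTerm_of_fibreIntegral_eq_zero s hC F ref V hne t, abs_zero]; exact mul_nonneg (abs_nonneg t) hδ
  · exact abs_dTerm_le s hm hC hF ref V hosc hne t

/-- `D` is `δ`-LIPSCHITZ on ℝ. [folklore] -/
theorem abs_dTerm_sub_dTerm_le (s : Finset (PBond P j)) {old : Density P j G} (hm : Measurable old) {C : ℝ}
    (hC : ∀ U, old U ≤ C) {F : Density P j G} (hF : Measurable F) (ref : GaugeField P j G → GaugeField P j G)
    (V : GaugeField P j G) {δ : ℝ}
    (hosc : ∀ y : s → G, old (updateFinset V s y) ≠ 0 → |F (updateFinset V s y) - F (ref V)| ≤ δ)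
    (hne : fibreIntegral s old V ≠ 0) (t t' : ℝ) : |dTerm s old F ref V t - dTerm s old F ref V t'| ≤ δ * |t - t'| := by
  haveI := isProbabilityMeasure_condLaw s hC V hne
  exact abs_cgf_sub_cgf_le_of_abs_le (μ := condLaw s old V) (measurable_fibreVar s hF ref V).aemeasurable
    (ae_abs_fibreVar_le s hm ref V hosc) t' t

/-- `|D′(t)| ≤ δ` everywhere. [folklore] -/
theorem abs_deriv_dTerm_le (s : Finset (PBond P j)) {old : Density P j G} (hm : Measurable old) {C : ℝ}
    (hC : ∀ U, old U ≤ C) {F : Density P j G} (hF : Measurable F) (ref : GaugeField P j G → GaugeField P j G)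
    (V : GaugeField P j G) {δ : ℝ}
    (hosc : ∀ y : s → G, old (updateFinset V s y) ≠ 0 → |F (updateFinset V s y) - F (ref V)| ≤ δ)
    (hne : fibreIntegral s old V ≠ 0) (t : ℝ) : |deriv (dTerm s old F ref V) t| ≤ δ := by
  haveI := isProbabilityMeasure_condLaw s hC V hne
  exact abs_deriv_cgf_le_of_abs_le (μ := condLaw s old V) (measurable_fibreVar s hF ref V).aemeasurable
    (ae_abs_fibreVar_le s hm ref V hosc) t

/-- `D` is REAL-ANALYTIC at every point of ℝ (no proviso needed: `D ≡ 0` in the degenerate case). [folklore] -/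
theorem analyticAt_dTerm (s : Finset (PBond P j)) {old : Density P j G} (hm : Measurable old) {C : ℝ} (hC : ∀ U, old U ≤ C)
    {F : Density P j G} (hF : Measurable F) (ref : GaugeField P j G → GaugeField P j G) (V : GaugeField P j G) {δ : ℝ}
    (hosc : ∀ y : s → G, old (updateFinset V s y) ≠ 0 → |F (updateFinset V s y) - F (ref V)| ≤ δ) (t : ℝ) :
    AnalyticAt ℝ (dTerm s old F ref V) t := by
  haveI := isZeroOrProbabilityMeasure_condLaw s hC V (old := old)
  exact analyticAt_cgf_of_abs_le (μ := condLaw s old V) (measurable_fibreVar s hF ref V).aemeasurable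
    (ae_abs_fibreVar_le s hm ref V hosc) t

/-- THE CONDITIONAL MEAN IN THE TREE'S TERMS: `E[F | V_out] = ∫ old(V←y)·F(V←y) dHaar^s(y) / ∫dV⌈_s old(V)` (Bochner integral
over the product Haar measure; `0` in the degenerate case). [folklore] -/
theorem condMean_eq_div (s : Finset (PBond P j)) {old : Density P j G} (hm : Measurable old) (h0 : ∀ U, 0 ≤ old U)
    (F : Density P j G) (V : GaugeField P j G) :
    condMean s old F V
      = (∫ y, old (updateFinset V s y) * F (updateFinset V s y) ∂(Measure.pi fun _ : s => (HaarData.haar : Measure G)))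
          / fibreIntegral s old V := by
  have hdens : Measurable fun y : s → G => ENNReal.ofReal (old (updateFinset V s y)) :=
    ENNReal.measurable_ofReal.comp (hm.comp measurable_updateFinset)
  have hpt : ∀ y : s → G, (ENNReal.ofReal (old (updateFinset V s y))).toReal • F (updateFinset V s y)
      = old (updateFinset V s y) * F (updateFinset V s y) := fun y => by
    rw [ENNReal.toReal_ofReal (h0 _), smul_eq_mul]
  rw [condMean, condLaw, integral_smul_measure, ENNReal.toReal_inv, toReal_fibreLaw_univ, fibreLaw,
    integral_withDensity_eq_integral_toReal_smul₀ hdens.aemeasurable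
      (Eventually.of_forall fun _ => ENNReal.ofReal_lt_top)]
  simp_rw [hpt]
  rw [smul_eq_mul, inv_mul_eq_div]

/-- The mean of the fibre variable is `E[F | V_out] − F(ref V)` (under the proviso). [folklore] -/
theorem integral_fibreVar (s : Finset (PBond P j)) {old : Density P j G} (hm : Measurable old) {C : ℝ} (hC : ∀ U, old U ≤ C)
    {F : Density P j G} (hF : Measurable F) (ref : GaugeField P j G → GaugeField P j G) (V : GaugeField P j G) {δ : ℝ}
    (hosc : ∀ y : s → G, old (updateFinset V s y) ≠ 0 → |F (updateFinset V s y) - F (ref V)| ≤ δ)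
    (hne : fibreIntegral s old V ≠ 0) :
    ∫ y, fibreVar s F ref V y ∂(condLaw s old V) = condMean s old F V - F (ref V) := by
  haveI := isProbabilityMeasure_condLaw s hC V hne
  have hXi : Integrable (fibreVar s F ref V) (condLaw s old V) :=
    integrable_of_abs_le_ae (measurable_fibreVar s hF ref V).aemeasurable (ae_abs_fibreVar_le s hm ref V hosc)
  have hFi : Integrable (fun y => F (updateFinset V s y)) (condLaw s old V) := by
    refine (hXi.add (integrable_const (F (ref V)))).congr (Eventually.of_forall fun y => ?_)
    simp only [Pi.add_apply, fibreVar, sub_add_cancel]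
  have e : ∫ y, fibreVar s F ref V y ∂(condLaw s old V)
      = (∫ y, F (updateFinset V s y) ∂(condLaw s old V)) - ∫ _y, F (ref V) ∂(condLaw s old V) :=
    integral_sub hFi (integrable_const _)
  rw [e, integral_const, probReal_univ, one_smul, condMean]

/-- FIRST ORDER: `D′(0) = E[F | V_out] − F(ref V)` — the conditional-mean shift of the exponent (the quantity NE1′ (b)
suppresses; here only identified, not sized). [folklore] -/
theorem hasDerivAt_dTerm_zero (s : Finset (PBond P j)) {old : Density P j G} (hm : Measurable old) {C : ℝ}
    (hC : ∀ U, old U ≤ C) {F : Density P j G} (hF : Measurable F) (ref : GaugeField P j G → GaugeField P j G)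
    (V : GaugeField P j G) {δ : ℝ}
    (hosc : ∀ y : s → G, old (updateFinset V s y) ≠ 0 → |F (updateFinset V s y) - F (ref V)| ≤ δ)
    (hne : fibreIntegral s old V ≠ 0) :
    HasDerivAt (dTerm s old F ref V) (condMean s old F V - F (ref V)) 0 := by
  haveI := isProbabilityMeasure_condLaw s hC V hne
  have h := hasDerivAt_cgf_zero_of_abs_le (μ := condLaw s old V) (measurable_fibreVar s hF ref V).aemeasurable
    (ae_abs_fibreVar_le s hm ref V hosc)
  rw [probReal_univ, div_one, integral_fibreVar s hm hC hF ref V hosc hne] at h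
  exact h

/-- … with `|E[F | V_out] − F(ref V)| ≤ δ`. [folklore] -/
theorem abs_condMean_sub_le (s : Finset (PBond P j)) {old : Density P j G} (hm : Measurable old) {C : ℝ}
    (hC : ∀ U, old U ≤ C) {F : Density P j G} (hF : Measurable F) (ref : GaugeField P j G → GaugeField P j G)
    (V : GaugeField P j G) {δ : ℝ}
    (hosc : ∀ y : s → G, old (updateFinset V s y) ≠ 0 → |F (updateFinset V s y) - F (ref V)| ≤ δ)
    (hne : fibreIntegral s old V ≠ 0) : |condMean s old F V - F (ref V)| ≤ δ := by
  haveI := isProbabilityMeasure_condLaw s hC V hne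
  rw [← integral_fibreVar s hm hC hF ref V hosc hne, ← Real.norm_eq_abs]
  have h := norm_integral_le_of_norm_le_const (μ := condLaw s old V) (f := fibreVar s F ref V) (C := δ)
    ((ae_abs_fibreVar_le s hm ref V hosc).mono fun y hy => by rwa [Real.norm_eq_abs])
  rwa [probReal_univ, mul_one] at h

/-- SECOND ORDER (Jensen side): `t·(E[F|V_out] − F(ref V)) ≤ D_t`. [folklore] -/
theorem mul_firstOrder_le_dTerm (s : Finset (PBond P j)) {old : Density P j G} (hm : Measurable old) {C : ℝ}
    (hC : ∀ U, old U ≤ C) {F : Density P j G} (hF : Measurable F) (ref : GaugeField P j G → GaugeField P j G)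
    (V : GaugeField P j G) {δ : ℝ}
    (hosc : ∀ y : s → G, old (updateFinset V s y) ≠ 0 → |F (updateFinset V s y) - F (ref V)| ≤ δ)
    (hne : fibreIntegral s old V ≠ 0) (t : ℝ) : t * (condMean s old F V - F (ref V)) ≤ dTerm s old F ref V t := by
  haveI := isProbabilityMeasure_condLaw s hC V hne
  rw [← integral_fibreVar s hm hC hF ref V hosc hne]
  exact mul_integral_le_cgf (μ := condLaw s old V) (measurable_fibreVar s hF ref V).aemeasurable
    (ae_abs_fibreVar_le s hm ref V hosc) t

/-- SECOND ORDER (two-sided): `|D_t − t·(E[F|V_out] − F(ref V))| ≤ t²δ²` for `|t|·δ ≤ 1`. [folklore] -/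
theorem abs_dTerm_sub_firstOrder_le (s : Finset (PBond P j)) {old : Density P j G} (hm : Measurable old) {C : ℝ}
    (hC : ∀ U, old U ≤ C) {F : Density P j G} (hF : Measurable F) (ref : GaugeField P j G → GaugeField P j G)
    (V : GaugeField P j G) {δ : ℝ}
    (hosc : ∀ y : s → G, old (updateFinset V s y) ≠ 0 → |F (updateFinset V s y) - F (ref V)| ≤ δ)
    (hne : fibreIntegral s old V ≠ 0) {t : ℝ} (ht : |t| * δ ≤ 1) :
    |dTerm s old F ref V t - t * (condMean s old F V - F (ref V))| ≤ t ^ 2 * δ ^ 2 := by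
  haveI := isProbabilityMeasure_condLaw s hC V hne
  rw [← integral_fibreVar s hm hC hF ref V hosc hne]
  exact abs_cgf_sub_mul_integral_le (μ := condLaw s old V) (measurable_fibreVar s hF ref V).aemeasurable
    (ae_abs_fibreVar_le s hm ref V hosc) ht

/-! ## §4 μ-analyticity: the complex D-term on a disc -/

/-- On the real axis the complex D-term is the real one. [folklore] -/
theorem dTermC_ofReal (s : Finset (PBond P j)) (old F : Density P j G) (ref : GaugeField P j G → GaugeField P j G)
    (V : GaugeField P j G) (t : ℝ) : dTermC s old F ref V (t : ℂ) = ((dTerm s old F ref V t : ℝ) : ℂ) :=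
  log_complexMGF_ofReal (X := fibreVar s F ref V) (μ := condLaw s old V) t

/-- `D_0 = 0` on the complex side. [folklore] -/
theorem dTermC_zero (s : Finset (PBond P j)) {old : Density P j G} {C : ℝ} (hC : ∀ U, old U ≤ C) (F : Density P j G)
    (ref : GaugeField P j G → GaugeField P j G) (V : GaugeField P j G) : dTermC s old F ref V 0 = 0 := by
  have h := dTermC_ofReal s old F ref V 0
  rw [dTerm_zero s hC F ref V, Complex.ofReal_zero] at h
  exact h

/-- μ-ANALYTICITY ON THE DISC OF RADIUS `1/(2δ)`: under the oscillation hypothesis on the support, the complex D-term is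
ℂ-differentiable (hence analytic) on `‖z‖ < r` whenever `2rδ ≤ 1` — the shape of the `MuAnalytic` slot of
`T4TermFormat.Carrier` for this carrier (no proviso needed: constant in the degenerate case). [folklore] -/
theorem differentiableOn_dTermC (s : Finset (PBond P j)) {old : Density P j G} (hm : Measurable old) {C : ℝ}
    (hC : ∀ U, old U ≤ C) {F : Density P j G} (hF : Measurable F) (ref : GaugeField P j G → GaugeField P j G)
    (V : GaugeField P j G) {δ : ℝ}
    (hosc : ∀ y : s → G, old (updateFinset V s y) ≠ 0 → |F (updateFinset V s y) - F (ref V)| ≤ δ)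
    {r : ℝ} (hr : 2 * (r * δ) ≤ 1) : DifferentiableOn ℂ (dTermC s old F ref V) (Metric.ball 0 r) := by
  by_cases hne : fibreIntegral s old V = 0
  · have h0 : condLaw s old V = 0 := condLaw_eq_zero s hC V hne
    have hconst : dTermC s old F ref V = fun _ => Complex.log 0 := by
      funext z; simp only [dTermC, h0, complexMGF, integral_zero_measure]
    rw [hconst]; exact differentiableOn_const _
  · haveI := isProbabilityMeasure_condLaw s hC V hne
    exact differentiableOn_log_complexMGF_ball (μ := condLaw s old V) (measurable_fibreVar s hF ref V).aemeasurable
      (ae_abs_fibreVar_le s hm ref V hosc) hr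

/-- NORM BOUND on the half disc: `‖D_z‖ ≤ 3‖z‖δ` for `4‖z‖δ ≤ 1` (under the proviso). [folklore] -/
theorem norm_dTermC_le (s : Finset (PBond P j)) {old : Density P j G} (hm : Measurable old) {C : ℝ} (hC : ∀ U, old U ≤ C)
    {F : Density P j G} (hF : Measurable F) (ref : GaugeField P j G → GaugeField P j G) (V : GaugeField P j G) {δ : ℝ}
    (hosc : ∀ y : s → G, old (updateFinset V s y) ≠ 0 → |F (updateFinset V s y) - F (ref V)| ≤ δ)
    (hne : fibreIntegral s old V ≠ 0) {z : ℂ} (hz : 4 * (‖z‖ * δ) ≤ 1) : ‖dTermC s old F ref V z‖ ≤ 3 * (‖z‖ * δ) := by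
  haveI := isProbabilityMeasure_condLaw s hC V hne
  exact norm_log_complexMGF_le (μ := condLaw s old V) (measurable_fibreVar s hF ref V).aemeasurable
    (ae_abs_fibreVar_le s hm ref V hosc) hz

/-! ## §5 Consumer: the budgets supplied by `LoopOscBound` (node O3c's hypothesis shape), one basic step -/

/-- WHERE NE1a IS SPENT: under `LoopOscBound av dom C_W θ`, for a closed walk at level `j + n ≤ m + K`, an integrated density
supported in `dom j` and a base point `V ∈ dom j` with non-vanishing fibre integral, the D-term of the loop dressing
`F = W_C(avg^n ·)` (reference = the base point) obeys `|D_t(V_out)| ≤ |t|·C_W·|w|·|Λ|·θⁿ`. [folklore] -/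
theorem abs_dTerm_loopDressing_le {av : ∀ i, Averaging P i G} {dom : ∀ i, Set (GaugeField P i G)} {C_W θ : ℝ}
    (hW : LoopOscBound av dom C_W θ) (n : ℕ) (hn : j + n ≤ P.m + P.K) (x : Site P (j + n)) (w : List (Letter P.d))
    (hw : walkEnd x w = x) (hFm : Measurable (loopDressing av j n x w)) (s : Finset (PBond P j))
    {old : Density P j G} (hm : Measurable old) {C : ℝ} (hC : ∀ U, old U ≤ C) (hdom : ∀ U, old U ≠ 0 → U ∈ dom j)
    (V : GaugeField P j G) (hV : V ∈ dom j) (hne : fibreIntegral s old V ≠ 0) (t : ℝ) :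
    |dTerm s old (loopDressing av j n x w) id V t| ≤ |t| * (C_W * (w.length : ℝ) * (s.card : ℝ) * θ ^ n) :=
  abs_dTerm_le s hm hC hFm id V (fun y hy => by
    have h := hW.updateFinset n hn x w hw s V y hV (hdom _ hy)
    rw [abs_sub_comm] at h
    exact h) hne t

/-- … its first-order coefficient: `|E[W_C(avg^n ·) | V_out] − W_C(avg^n V)| ≤ C_W·|w|·|Λ|·θⁿ`. [folklore] -/
theorem abs_condMean_loopDressing_sub_le {av : ∀ i, Averaging P i G} {dom : ∀ i, Set (GaugeField P i G)} {C_W θ : ℝ}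
    (hW : LoopOscBound av dom C_W θ) (n : ℕ) (hn : j + n ≤ P.m + P.K) (x : Site P (j + n)) (w : List (Letter P.d))
    (hw : walkEnd x w = x) (hFm : Measurable (loopDressing av j n x w)) (s : Finset (PBond P j))
    {old : Density P j G} (hm : Measurable old) {C : ℝ} (hC : ∀ U, old U ≤ C) (hdom : ∀ U, old U ≠ 0 → U ∈ dom j)
    (V : GaugeField P j G) (hV : V ∈ dom j) (hne : fibreIntegral s old V ≠ 0) :
    |condMean s old (loopDressing av j n x w) V - loopDressing av j n x w V|
      ≤ C_W * (w.length : ℝ) * (s.card : ℝ) * θ ^ n :=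
  abs_condMean_sub_le s hm hC hFm id V (fun y hy => by
    have h := hW.updateFinset n hn x w hw s V y hV (hdom _ hy)
    rw [abs_sub_comm] at h
    exact h) hne

/-- … and its μ-ANALYTICITY RADIUS: the complex D-term of the loop dressing is ℂ-differentiable on `‖z‖ < r` whenever
`2r·C_W·|w|·|Λ|·θⁿ ≤ 1`. [folklore] -/
theorem differentiableOn_dTermC_loopDressing {av : ∀ i, Averaging P i G} {dom : ∀ i, Set (GaugeField P i G)}
    {C_W θ : ℝ} (hW : LoopOscBound av dom C_W θ) (n : ℕ) (hn : j + n ≤ P.m + P.K) (x : Site P (j + n))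
    (w : List (Letter P.d)) (hw : walkEnd x w = x) (hFm : Measurable (loopDressing av j n x w)) (s : Finset (PBond P j))
    {old : Density P j G} (hm : Measurable old) {C : ℝ} (hC : ∀ U, old U ≤ C) (hdom : ∀ U, old U ≠ 0 → U ∈ dom j)
    (V : GaugeField P j G) (hV : V ∈ dom j) {r : ℝ} (hr : 2 * (r * (C_W * (w.length : ℝ) * (s.card : ℝ) * θ ^ n)) ≤ 1) :
    DifferentiableOn ℂ (dTermC s old (loopDressing av j n x w) id V) (Metric.ball 0 r) :=
  differentiableOn_dTermC s hm hC hFm id V (fun y hy => by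
    have h := hW.updateFinset n hn x w hw s V y hV (hdom _ hy)
    rw [abs_sub_comm] at h
    exact h) hr

end SetupLevel

end Literature.MathematicalPhysics.QuantumFieldTheory.Balaban1983to89.T4DressingDefect
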